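import Summits.ValiantsHypothesis.ValiantsHypothesis.Theorems.GrenetZeonDualUnipotentThreeHalvesLongMassNilSpaceMaxRank

/-!
# `GrenetZeon.DualUnipotentThreeHalves` (stmt-ValiantsHypothesis-24318), line `slow_core`, stub (c) `SlowCore.LongMassSlowLawInv`:
# the MAX-RANK CHAIN LEMMA (Flanders' lemma to all orders)

Sequel of ✓ `NilSpaceMaxRank` (p842208: `A` of maximal rank in a linear space `V ≤ M_b(ℂ)` ⇒ every `B ∈ V` maps `ker A` into `range A`).
Iterating, a vector `u₀ ∈ ker A` starts an `A–B` CHAIN `u₀, u₁, …, u_k` with `B u_i = A u_{i+1}` (`i < k`).  The full first-order content of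
«`rank (A + tB) ≤ rank A` for all `t`» (Flanders 1962; Atkinson–Lloyd; Meshulam 1985 — in normalised coordinates `A = 1 ⊕ 0`,
`B = [[B₁,B₂],[B₃,B₄]]`: `B₄ = 0` AND `B₃ B₁^i B₂ = 0` for every `i`) is that EVERY such chain continues: `B u_k ∈ range A`.

* ★ `chain_mulVec` — the telescoping identity `(A + tB)·(Σ_{i≤k} (−t)^i u_i) = ((−t)^k·t)·B u_k` for a chain;
* ★★★ `exists_mulVec_eq_of_maxRank_chain` — MAX-RANK CHAIN LEMMA: `A ∈ V` of maximal rank, `B ∈ V`, `A u₀ = 0`, `B u_i = A u_{i+1}` (`i < k`)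
  ⇒ `B u_k = A z` for some `z`.  (Same perturbation as in ✓ `exists_mulVec_eq_of_maxRank`, with the test column `Σ (−t)^i u_i`: the
  `(r+1) × (r+1)` matrix `P (A + tB) J(t)` has determinant `(−t)^k t · g(t)`, `g(0) = 1`.)
* `exists_mulVec_eq_of_maxRank_chain_two` — the case `k = 1` spelled out: `A u = 0`, `B u = A z` ⇒ `B z ∈ range A`.

For the (c)-enemy (nilpotent spaces, where a generic element has maximal rank): the rank-side analogue of the chain sandwich
(✓ `NilSpaceSandwich.chain_sandwich_eq_zero`) — every `A–B` chain out of `ker A` lifts forever inside `range A`.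

HONEST FRAMING.  Support lemma (`--supports stmt-ValiantsHypothesis-24318`), classical structural law; NOT progress on (c) (RESEARCH — OPEN); closes no
stub; S3, 24318, 8062, `VP ≠ VNP` NOT proved.  Def-free, no named facts, no sorry.
[cite: Flanders1962, Lemma 1] [cite: Meshulam1985, Lemma 1]
-/

set_option linter.dupNamespace false
set_option autoImplicit false

noncomputable section

namespace Summit.ValiantsHypothesis.ValiantsHypothesis.Theorems.GrenetZeon.NilSpaceMaxRank

open Matrix
open scoped BigOperators

variable {b : ℕ}

/-! ## §1 The telescoping identity of an `A–B` chain -/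

/-- ★ For an `A–B` chain `u₀ ∈ ker A`, `B u_i = A u_{i+1}` (`i < k`): `(A + tB)·(Σ_{i≤k} (−t)^i u_i) = ((−t)^k·t)·B u_k`. -/
theorem chain_mulVec (A B : Matrix (Fin b) (Fin b) ℂ) (useq : ℕ → Fin b → ℂ) (t : ℂ) (h0 : A *ᵥ useq 0 = 0) :
    ∀ k : ℕ, (∀ i, i < k → B *ᵥ useq i = A *ᵥ useq (i + 1)) →
      (A + t • B) *ᵥ (∑ i ∈ Finset.range (k + 1), (-t) ^ i • useq i) = ((-t) ^ k * t) • (B *ᵥ useq k) := by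
  intro k
  induction k with
  | zero =>
    intro _
    rw [Finset.sum_range_one, pow_zero, one_smul, Matrix.add_mulVec, Matrix.smul_mulVec, h0, zero_add, one_mul]
  | succ k ih =>
    intro hch
    have ih' := ih fun i hi => hch i (Nat.lt_succ_of_lt hi)
    have hk := hch k (Nat.lt_succ_self k)
    rw [Finset.sum_range_succ, Matrix.mulVec_add, ih', hk, Matrix.mulVec_smul, Matrix.add_mulVec, Matrix.smul_mulVec]
    ext i
    simp only [Pi.add_apply, Pi.smul_apply, smul_eq_mul]
    ring

/-! ## §2 The max-rank chain lemma -/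

/-- ★★★ **MAX-RANK CHAIN LEMMA** (Flanders' lemma to all orders).  In a linear space `V ≤ M_b(ℂ)`, let `A ∈ V` have maximal rank and `B ∈ V`.
If `A u₀ = 0` and `B u_i = A u_{i+1}` for all `i < k`, then `B u_k ∈ range A`. [cite: Flanders1962, Lemma 1] [cite: Meshulam1985, Lemma 1] -/
theorem exists_mulVec_eq_of_maxRank_chain (V : Submodule ℂ (Matrix (Fin b) (Fin b) ℂ)) {A : Matrix (Fin b) (Fin b) ℂ} (hA : A ∈ V)
    (hmax : ∀ B ∈ V, B.rank ≤ A.rank) {B : Matrix (Fin b) (Fin b) ℂ} (hB : B ∈ V) (useq : ℕ → Fin b → ℂ)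
    (h0 : A *ᵥ useq 0 = 0) (k : ℕ) (hch : ∀ i, i < k → B *ᵥ useq i = A *ᵥ useq (i + 1)) :
    ∃ z : Fin b → ℂ, B *ᵥ useq k = A *ᵥ z := by
  classical
  set R : Submodule ℂ (Fin b → ℂ) := LinearMap.range (Matrix.mulVecLin A) with hR
  by_contra hcon
  push Not at hcon
  have hBu : B *ᵥ useq k ∉ R := by
    rintro ⟨z, hz⟩
    exact hcon z (by rw [← hz, Matrix.mulVecLin_apply])
  set r : ℕ := Module.finrank ℂ R with hr
  have hrank : A.rank = r := rfl
  let bR := Module.finBasis ℂ R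
  have hv0 : ∀ i : Fin r, ∃ y : Fin b → ℂ, A *ᵥ y = (bR i : Fin b → ℂ) := fun i => by
    obtain ⟨y, hy⟩ := (bR i).2
    exact ⟨y, by rw [← hy, Matrix.mulVecLin_apply]⟩
  choose v hv using hv0
  -- the independent columns `Wm = [A v | B u_k]` and a left inverse `P`
  set wcols : Fin (r + 1) → Fin b → ℂ :=
    Fin.snoc (α := fun _ => Fin b → ℂ) (fun i : Fin r => (bR i : Fin b → ℂ)) (B *ᵥ useq k) with hwcols
  set Wm : Matrix (Fin b) (Fin (r + 1)) ℂ := Matrix.of fun i j => wcols j i with hWm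
  have hker : LinearMap.ker (Matrix.mulVecLin Wm) = ⊥ := by
    rw [LinearMap.ker_eq_bot']
    intro c hc
    rw [Matrix.mulVecLin_apply, hWm, of_cols_mulVec, Fin.sum_univ_castSucc] at hc
    simp only [hwcols, Fin.snoc_castSucc, Fin.snoc_last] at hc
    have hlast : c (Fin.last r) = 0 := by
      by_contra hne
      apply hBu
      have e : B *ᵥ useq k = -((c (Fin.last r))⁻¹ • ∑ i : Fin r, c (Fin.castSucc i) • (bR i : Fin b → ℂ)) := by
        have e1 : c (Fin.last r) • B *ᵥ useq k = -(∑ i : Fin r, c (Fin.castSucc i) • (bR i : Fin b → ℂ)) :=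
          eq_neg_of_add_eq_zero_right hc
        rw [← smul_neg, ← e1, smul_smul, inv_mul_cancel₀ hne, one_smul]
      rw [e]
      exact R.neg_mem (R.smul_mem _ (Submodule.sum_mem _ fun i _ => R.smul_mem _ (bR i).2))
    rw [hlast, zero_smul, add_zero] at hc
    have hc' : ∑ i : Fin r, c (Fin.castSucc i) • bR i = 0 := by
      apply Subtype.ext
      rw [Submodule.coe_sum, Submodule.coe_zero]
      simpa only [Submodule.coe_smul] using hc
    have hcs : ∀ i, c (Fin.castSucc i) = 0 := Fintype.linearIndependent_iff.mp bR.linearIndependent _ hc'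
    funext j
    refine Fin.lastCases ?_ (fun i => ?_) j
    · exact hlast
    · exact hcs i
  obtain ⟨g, hg⟩ := LinearMap.exists_leftInverse_of_injective (Matrix.mulVecLin Wm) hker
  set P : Matrix (Fin (r + 1)) (Fin b) ℂ := LinearMap.toMatrix' g with hP
  have hPW : P * Wm = 1 := by
    have e : LinearMap.toMatrix' (g.comp (Matrix.mulVecLin Wm)) = LinearMap.toMatrix' (LinearMap.id : (Fin (r + 1) → ℂ) →ₗ[ℂ] _) := by
      rw [hg]
    rw [LinearMap.toMatrix'_comp, LinearMap.toMatrix'_id, ← Matrix.toLin'_apply', LinearMap.toMatrix'_toLin'] at e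
    rw [hP]
    exact e
  have hPw : ∀ j i, (P *ᵥ wcols j) i = (1 : Matrix (Fin (r + 1)) (Fin (r + 1)) ℂ) i j := by
    intro j i
    have e : (fun j' => Wm j' j) = wcols j := by funext j'; rw [hWm, Matrix.of_apply]
    rw [← hPW, mul_apply_eq_mulVec_col, e]
  -- the `t`-independent part of the test matrix and the choice of `t`
  set N₁ : Matrix (Fin (r + 1)) (Fin (r + 1)) ℂ :=
    Matrix.of fun i j => Fin.lastCases (motive := fun _ => ℂ) 0 (fun j' : Fin r => (P *ᵥ (B *ᵥ v j')) i) j with hN₁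
  obtain ⟨t, ht0, hdet⟩ := exists_ne_zero_det_ne_zero (1 : Matrix (Fin (r + 1)) (Fin (r + 1)) ℂ) N₁ rfl
  have hτ : (-t) ^ k * t ≠ 0 := mul_ne_zero (pow_ne_zero _ (neg_ne_zero.mpr ht0)) ht0
  -- the test columns `J(t) = [v | Σ (−t)^i u_i]`
  set q : Fin b → ℂ := ∑ i ∈ Finset.range (k + 1), (-t) ^ i • useq i with hq
  have hq' : (A + t • B) *ᵥ q = ((-t) ^ k * t) • (B *ᵥ useq k) := chain_mulVec A B useq t h0 k hch
  set cols : Fin (r + 1) → Fin b → ℂ := Fin.snoc (α := fun _ => Fin b → ℂ) v q with hcols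
  set J : Matrix (Fin b) (Fin (r + 1)) ℂ := Matrix.of fun i j => cols j i with hJ
  -- entries of `G(t) = P (A + tB) J(t)`
  have hcolJ : ∀ j, (fun j' => J j' j) = cols j := fun j => by funext j'; rw [hJ, Matrix.of_apply]
  have hG : P * ((A + t • B) * J) =
      ((1 : Matrix (Fin (r + 1)) (Fin (r + 1)) ℂ) + t • N₁).updateCol (Fin.last r)
        (((-t) ^ k * t) • fun i => (1 : Matrix (Fin (r + 1)) (Fin (r + 1)) ℂ) i (Fin.last r)) := by
    ext i j
    rw [← Matrix.mul_assoc, mul_apply_eq_mulVec_col, hcolJ, ← Matrix.mulVec_mulVec, Matrix.updateCol_apply]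
    refine Fin.lastCases ?_ (fun j' => ?_) j
    · rw [if_pos rfl, hcols, Fin.snoc_last, hq', Matrix.mulVec_smul, Pi.smul_apply, Pi.smul_apply, smul_eq_mul, smul_eq_mul,
        ← hPw (Fin.last r) i, hwcols, Fin.snoc_last]
    · rw [if_neg (Fin.castSucc_lt_last j').ne, hcols, Fin.snoc_castSucc, Matrix.add_mulVec, Matrix.smul_mulVec, hv j',
        Matrix.mulVec_add, Matrix.mulVec_smul, Matrix.add_apply, Matrix.smul_apply, Pi.add_apply, Pi.smul_apply]
      have e1 : (P *ᵥ (bR j' : Fin b → ℂ)) i = (1 : Matrix (Fin (r + 1)) (Fin (r + 1)) ℂ) i (Fin.castSucc j') := by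
        rw [← hPw (Fin.castSucc j') i, hwcols, Fin.snoc_castSucc]
      have e2 : N₁ i (Fin.castSucc j') = (P *ᵥ (B *ᵥ v j')) i := by
        rw [hN₁, Matrix.of_apply, Fin.lastCases_castSucc]
      rw [e1, e2]
  have hself : ((1 : Matrix (Fin (r + 1)) (Fin (r + 1)) ℂ) + t • N₁).updateCol (Fin.last r)
      (fun i => (1 : Matrix (Fin (r + 1)) (Fin (r + 1)) ℂ) i (Fin.last r)) = 1 + t • N₁ := by
    have e : (fun i => (1 : Matrix (Fin (r + 1)) (Fin (r + 1)) ℂ) i (Fin.last r)) =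
        fun i => ((1 : Matrix (Fin (r + 1)) (Fin (r + 1)) ℂ) + t • N₁) i (Fin.last r) := by
      funext i
      rw [Matrix.add_apply, Matrix.smul_apply, hN₁, Matrix.of_apply, Fin.lastCases_last, smul_zero, add_zero]
    rw [e, Matrix.updateCol_eq_self]
  have hdetG : (P * ((A + t • B) * J)).det ≠ 0 := by
    rw [hG, Matrix.det_updateCol_smul, hself]
    exact mul_ne_zero hτ hdet
  have hunit : IsUnit (P * ((A + t • B) * J)) :=
    (Matrix.isUnit_iff_isUnit_det _).mpr (isUnit_iff_ne_zero.mpr hdetG)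
  have h1 : (P * ((A + t • B) * J)).rank = r + 1 := by
    rw [Matrix.rank_of_isUnit _ hunit, Fintype.card_fin]
  have h2 : (P * ((A + t • B) * J)).rank ≤ (A + t • B).rank :=
    (Matrix.rank_mul_le_right _ _).trans (Matrix.rank_mul_le_left _ _)
  have h3 : (A + t • B).rank ≤ A.rank := hmax _ (V.add_mem hA (V.smul_mem t hB))
  rw [h1] at h2
  rw [hrank] at h3
  omega

/-- The case `k = 1` spelled out: `A u = 0` and `B u = A z` ⇒ `B z ∈ range A` (in normalised coordinates `B₃ B₂ = 0`).
[cite: Flanders1962, Lemma 1] -/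
theorem exists_mulVec_eq_of_maxRank_chain_two (V : Submodule ℂ (Matrix (Fin b) (Fin b) ℂ)) {A : Matrix (Fin b) (Fin b) ℂ} (hA : A ∈ V)
    (hmax : ∀ B ∈ V, B.rank ≤ A.rank) {B : Matrix (Fin b) (Fin b) ℂ} (hB : B ∈ V) {u z : Fin b → ℂ}
    (hu : A *ᵥ u = 0) (hz : B *ᵥ u = A *ᵥ z) : ∃ z' : Fin b → ℂ, B *ᵥ z = A *ᵥ z' := by
  have h := exists_mulVec_eq_of_maxRank_chain V hA hmax hB (fun i => if i = 0 then u else z) (by simpa using hu) 1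
    (fun i hi => by
      have hi0 : i = 0 := by omega
      subst hi0
      simpa using hz)
  simpa using h

/-! ## §3 Polarised second order (the bilinear Flanders condition)

(Append, same hand.)  Applying the case `k = 1` to `B + B' ∈ V` and subtracting the two pure cases gives the POLARISED law used in Flanders'
dimension count (normalised coordinates: `B₃ B₂' + B₃' B₂ = 0`). -/

/-- ★★ **POLARISED SECOND-ORDER MAX-RANK LAW.**  `A ∈ V` of maximal rank, `B, B' ∈ V`, `A u = 0`, `B u = A z`, `B' u = A z'` ⇒
`B z' + B' z ∈ range A`. [cite: Flanders1962, Lemma 1] -/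
theorem exists_mulVec_add_mulVec_eq_of_maxRank (V : Submodule ℂ (Matrix (Fin b) (Fin b) ℂ)) {A : Matrix (Fin b) (Fin b) ℂ} (hA : A ∈ V)
    (hmax : ∀ B ∈ V, B.rank ≤ A.rank) {B B' : Matrix (Fin b) (Fin b) ℂ} (hB : B ∈ V) (hB' : B' ∈ V) {u z z' : Fin b → ℂ}
    (hu : A *ᵥ u = 0) (hz : B *ᵥ u = A *ᵥ z) (hz' : B' *ᵥ u = A *ᵥ z') :
    ∃ w : Fin b → ℂ, B *ᵥ z' + B' *ᵥ z = A *ᵥ w := by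
  -- the sum `B + B'` with the chain `u, z + z'`
  have hsum : (B + B') *ᵥ u = A *ᵥ (z + z') := by rw [Matrix.add_mulVec, hz, hz', Matrix.mulVec_add]
  obtain ⟨w₁, hw₁⟩ := exists_mulVec_eq_of_maxRank_chain_two V hA hmax (V.add_mem hB hB') hu hsum
  obtain ⟨w₂, hw₂⟩ := exists_mulVec_eq_of_maxRank_chain_two V hA hmax hB hu hz
  obtain ⟨w₃, hw₃⟩ := exists_mulVec_eq_of_maxRank_chain_two V hA hmax hB' hu hz'
  refine ⟨w₁ - w₂ - w₃, ?_⟩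
  have e : B *ᵥ z' + B' *ᵥ z = (B + B') *ᵥ (z + z') - B *ᵥ z - B' *ᵥ z' := by
    rw [Matrix.add_mulVec, Matrix.mulVec_add, Matrix.mulVec_add]
    abel
  rw [e, hw₁, hw₂, hw₃, Matrix.mulVec_sub, Matrix.mulVec_sub]

end Summit.ValiantsHypothesis.ValiantsHypothesis.Theorems.GrenetZeon.NilSpaceMaxRank

end
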